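import Literature.MathematicalPhysics.QuantumFieldTheory.Balaban1983to89.B8SockLettersRD
import Literature.MathematicalPhysics.QuantumFieldTheory.Balaban1983to89.B8IdxB8LawsB
import Literature.MathematicalPhysics.QuantumFieldTheory.Balaban1983to89.B8Prop6OfThm4
import Literature.MathematicalPhysics.QuantumFieldTheory.Balaban1983to89.B8Eq131Cubes
import Literature.MathematicalPhysics.QuantumFieldTheory.Balaban1983to89.B8Eq106Local
import Literature.MathematicalPhysics.QuantumFieldTheory.Balaban1983to89.B8Eq138LandauZd

/-!
# `Balaban1983to89.B8SockLettersRDIdxB8LawsBVacuity` — KERNEL CERTIFICATE: the [4]-LETTERS BINDERS `SLet` ∕ `SLetUB` OF THE N05 KNITS OF RECORD, DEMANDED AT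
# EVERY `Ω₀ = ℤᵈ` MEMBER OBEYING THE FOUR LOCATED LAWS (`IdxB8LawsB`) AND (1.3)–(1.4) (`DomainSeq`), ARE UNSATISFIABLE — the located laws omit print's (1.5)
# `Λ_j = Ω_j^{(j)} ∖ Ω_{j+1}^{(j)}`; at the all-`ℤᵈ` datum `Λs ≡ ⊤` (lawful, admissible) [4]'s interpolation operator `H′` with `Q′_j H′Y = Y_j on Λ_j` cannot exist

statement-level skeleton of published theorems with citation tags; proofs where landed; nothing here is a claim about the Yang–Mills mass gap

T. Bałaban, *Spaces of regular gauge field configurations on a lattice and gauge fixing conditions*, Commun. Math. Phys. **99** (1985) 75–102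
`[Balaban1985RegularSpaces]` ("B8"; journal page = PDF page + 74): (1.3)–(1.6) p. 77 («Λ_j = Ω_j^{(j)} ∖ Ω_{j+1}^{(j)}, j = 0, …, k − 1, Λ_k = Ω_k^{(k)}» — the
constraint towers of different levels are DISJOINT), p. 77 «we admit the case where some domains Ω_j are equal to T_η», (1.107) p. 94; [4] = T. Bałaban, *Propagators
for lattice gauge theories in a background field*, Commun. Math. Phys. **99** (1985) 389–434 `[Balaban1985BackgroundPropagators]`: p. 394 (the structure `𝔅_k`), (1.91)–(1.92)
∕ Thm 3.1 p. 397 (the operator `H′` with `Q′H′ = I` on the constraint space).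

## WHY THIS FILE (cell `pub-ymgap`, HUMAN RULING D-0062; width seat `pub-ymgap-dag-n05-w1` g2, DAG node N05 = [B8]; proof lane, count-neutral)

The «P₂C» knits of record (dag-n05-d p606531 ∕ p605228 lineage, p609803 `…N05SubBP2CSlotExistsGammaPrime`) display, among their hypotheses, [4]'s letters at the law
members in two shapes: `SLet : ∀ i : ZdIdx d L, i.Ω 0 = univ → IdxB8LawsB L i → DomainSeq L i.Ω → SockLettersRD L BG BR B₀′H B₂′ cL i.η i.k i.Ω i.Λs` and the uniqueness-side
display `SLetUB : ∀ i, … → ∀ α₀ …, ∀ U₀ unitary, U₀ ∈ 𝔄_k → ∃ (g Δ q qs Aw c H′), …`.  Both contain [4]'s INTERPOLATION CLAUSE «`Q′_j(U₀) (H′Y)(y) = Y(j, y)` for every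
`j` and every `y ∈ Λ_j`» (print (1.107) ∕ [4] `Q′H′ = I`), which is consistent ONLY because print's constraint sets `Λ_j` are the disjoint layers (1.5).  NODE 00's located
laws (№7 scale, №8 truncation, №11 cover = (1.6), №12 bonds; `Node00.IdxB8Laws` ∕ `B8IdxB8LawsB.IdxB8LawsB`) and print's (1.3)–(1.4) (`B8ConstraintBonds.DomainSeq`) do NOT carry
(1.5): the datum `i⋆ = {η := L⁻¹, k := 1, Ω_j := ℤᵈ, Λs m j := ℤᵈ, Λb m j := ⊤}` obeys all of them (§1), and at `i⋆` the interpolation clause forces, for the bounded family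
`Y⋆ := (level 0 ↦ 0, level 1 ↦ 1)`, first `H′Y⋆ = 0` (level 0 on `Λ₀ = ℤᵈ`, `Q′₀ = id`) and then `Q′₁(0)(0) = 1`, i.e. `0 = 1` in `𝔸` (§2).  This is EXACTLY referee ref-A
g15 READ-23's mechanism (`sletL_sub3_unsatisfiable`, 2026-08-27, for the three-law `ZdLanIdx` index — «the refutation needs only `Λ₀ = univ ∧ Λ₁ ≠ ∅`»; repaired THERE by
dag-n05-c's `B8Prop5LandauIdxLayer.ZdLanIdxSub4` = (1.5) as `TowerDisjoint`), transported to the `IdxB8LawsB`-keyed binders, which were re-keyed later without (1.5).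
CONSEQUENCE (§3–§4): each of `SLet`, `SLetUB` is an unsatisfiable hypothesis, so every theorem displaying either holds EX FALSO at every `θ` — a TYPING defect of the
binders' member class (wider than print's family), not a refutation of anything in [B8] ∕ [4]; the honest binder ranges over the (1.5)-obeying members (a fifth located law —
dag-n05-w6 ∕ dag-n05-w2's reading «`∀ l < k, ∀ z ∈ Λs k l, Lˡ•z ∈ Lam L Ω l`», or dag-n05-c's `TowerDisjoint` on the `ZdLanIdx` reading — the class ∕ index owners' word).

## WHAT IS PROVED (kernel, 0 sorry, 0 def; axioms `propext` ∕ `Classical.choice` ∕ `Quot.sound`)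

* §1 `exists_member_allUniv` — the witness `i⋆`: `i⋆.Ω 0 = univ ∧ IdxB8LawsB L i⋆ ∧ DomainSeq L i⋆.Ω ∧ i⋆.k = 1 ∧ 0 < i⋆.η ∧ (∀ j, i⋆.Ω j = univ) ∧ ∀ m j, i⋆.Λs m j = univ`
  (every `d`, every `L ≥ 1`).
* §2 `interp_clause_false` (the interpolation clause ALONE over `Λ₀ = Λ₁ = ℤᵈ` at `k ≥ 1` is contradictory, any linear `H′`, any background), `not_sockLettersRD_allUniv`
  (`¬ SockLettersRD L BG BR B₀′H B₂′ cL η k (fun _ => univ) (fun _ _ => univ)` for `0 < cL`, `0 < η`, `1 ≤ k`, `1 ≤ L`, nontrivial C⋆ `𝔸`).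
* §3 ★★ `sLet_idxB8LawsB_unsatisfiable` (the `SLet` text of p609803 :150, generic in `d L 𝔸`: `… → False`), ★ `sLetUB_idxB8LawsB_unsatisfiable` (the `SLetUB` text of p609803 :153–:170).
* §4 `sLet_idxB8LawsB_unsatisfiable_stage3` ∕ `sLetUB_idxB8LawsB_unsatisfiable_stage3` (the instances at `θ.D θ.L θ.𝔸`, `θ : Node00.Stage3Params`, the letter the knits display).

## HONEST SCOPE

A NEGATIVE TYPING CERTIFICATE about two displayed hypotheses; 0 estimates; nothing of [B8] ∕ [4] asserted or refuted ([4] Thm 3.1's letters at print's (1.5)-families are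
untouched — N06 content); it does not say the knits are wrong — it says they assert nothing until their letters binders are re-keyed on the (1.5)-obeying members.
Count-neutral; N05 NOT discharged; `T_η ↦ ℤᵈ`; one finite `T⁴` programme at fixed `ε`, Bałaban as printed — nothing continuum ∕ ℝ⁴ ∕ OS ∕ mass-gap ∕ Clay.
No `sorry`, no `instance`, no `notation`.  Unit `pub-ymgap-dag-n05-w1` (g2), 2026-08-28.

[cite: Balaban1985RegularSpaces, (1.3)–(1.6) p.77, p.77 («Ω_j = T_η»), (1.107) p.94; Balaban1985BackgroundPropagators, p.394 (`𝔅_k`), Thm 3.1 p.397]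
-/

noncomputable section

open NormedSpace

namespace Literature.MathematicalPhysics.QuantumFieldTheory.Balaban1983to89.B8SockLettersRDIdxB8LawsBVacuity

open B7Prop1Explicit B7Prop1Local
open B7Prop2Explicit (unitaryUnits)
open B7Eq78Linearization (zdBlocking QprimeIter)
open B8Ineq130 (tlo thi)
open B8Ineq132 (covDerivFwd InAk Under)
open B8Eq119TwistedAxial (bgT)
open B8Eq140Level (SideTouches)
open B8Eq138LandauZd (covLap QT)
open B8Eq1117Concrete (XSpace)
open B8Prop5ContractionKLevel (Bd2)
open B8LambdaSpaceKLevel (wt)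
open B8LeafModelZd (ZdIdx)
open B8Eq131Cubes (flm under_flm)
open B8Eq106Local (under_iff_tower)
open B8ConstraintBonds (DomainSeq)
open B8IdxB8LawsB (IdxB8LawsB towerBonds_univ_self)
open B8SockLettersRD (SockLettersRD)

-- `Site` alone could resolve to the torus sites of `Setup.lean`; re-export the `ℤ^d` sites of `B7Prop1Explicit`.
export B7Prop1Explicit (Site)

variable {d : ℕ}

/-! ## §1 The witness: the all-`ℤᵈ` datum with ALL constraint sets `ℤᵈ` obeys the four located laws and (1.3)–(1.4) -/

/-- **THE WITNESS `i⋆`**: spacing `η := L⁻¹`, `k := 1`, `Ω_j := ℤᵈ` for every `j` (print p. 77 «we admit Ω_j = T_η»), constraint sites `Λs m j := ℤᵈ` for EVERY truncation and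
level (towers of levels `0` and `1` through every site — exactly what (1.5) forbids), bond classes `Λb := ⊤` (= `towerBonds` of these, law №12); it obeys `ZdIdx`'s box ∕ class ∕
tower ∕ partition clauses, NODE 00's four located laws (`scale` with equality, `trunc_lt` vacuous, `trunc_top` and `cover` trivially on `ℤᵈ`), and `DomainSeq` (constant sequence).
[cite: Balaban1985RegularSpaces, (1.3)–(1.6) p.77, p.77 («Ω_j = T_η»), (1.19) p.79, (1.34) p.82, p.86 («𝔅_k»)] -/
theorem exists_member_allUniv {L : ℕ} (hL : 1 ≤ L) :
    ∃ i : ZdIdx d L, i.Ω 0 = Set.univ ∧ IdxB8LawsB L i ∧ DomainSeq L i.Ω ∧ i.k = 1 ∧ 0 < i.η ∧ (∀ j, i.Ω j = Set.univ) ∧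
      ∀ m j, i.Λs m j = Set.univ := by
  classical
  have hL0 : (0 : ℝ) < L := by exact_mod_cast (show 0 < L by omega)
  have hη : (0 : ℝ) < (L : ℝ)⁻¹ := inv_pos.mpr hL0
  let i : ZdIdx d L :=
    ⟨(L : ℝ)⁻¹, hη, 1, le_rfl, fun _ => Set.univ, fun _ => le_rfl, fun _ _ => Set.univ, fun _ _ => Set.univ,
      fun _ _ _ _ _ _ _ _ => Set.mem_univ _, fun _ _ _ _ _ _ => Or.inl ⟨Set.mem_univ _, Set.mem_univ _⟩, fun _ _ _ _ _ _ => Set.mem_univ _,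
      fun x _ => ⟨1, le_rfl, flm L 1 x, Set.mem_univ _, fun ii =>
        ⟨((under_iff_tower L 1 (flm L 1 x) x).1 (under_flm hL 1 x)).1 ii, ((under_iff_tower L 1 (flm L 1 x) x).1 (under_flm hL 1 x)).2 ii⟩⟩⟩
  have hlaws : Node00.IdxB8Laws L i :=
    { scale := by
        show (L : ℝ) ^ 1 * (L : ℝ)⁻¹ ≤ 1
        rw [pow_one, mul_inv_cancel₀ hL0.ne']
      trunc_lt := fun _ _ _ _ => rfl
      trunc_top := fun _ _ _ => ⟨fun _ => Or.inl (Set.mem_univ _), fun _ => Set.mem_univ _⟩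
      cover := fun ℓ hℓ w _ => ⟨i.k, hℓ, le_rfl, flm L (i.k - ℓ) w, Set.mem_univ _, under_flm hL (i.k - ℓ) w⟩ }
  refine ⟨i, rfl, ⟨hlaws, fun m j => ?_⟩, ⟨fun _ => le_rfl, fun _ _ _ _ _ => Set.mem_univ _, fun _ _ _ _ _ => Set.mem_univ _⟩, rfl, hη,
    fun _ => rfl, fun _ _ => rfl⟩
  show (Set.univ : Set (Site d × Fin d)) = _
  exact (towerBonds_univ_self L (Ω := i.Ω) (Λ := i.Λs m) (j := j) rfl rfl).symm

/-! ## §2 The interpolation clause over `Λ₀ = Λ₁ = ℤᵈ` is contradictory; `SockLettersRD` fails at the witness -/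

section Interp

variable {𝔸 : Type*} [CStarAlgebra 𝔸] [Nontrivial 𝔸]

/-- **[4]'s INTERPOLATION CLAUSE ALONE IS CONTRADICTORY when levels `0` and `1` are both constrained on all of `ℤᵈ`** (`k ≥ 1`, any background `U₀`, ANY map `H′`):
the bounded family `Y⋆ := (j, y) ↦ [j = 1]·1` would need `H′Y⋆ = Y⋆(0, ·) = 0` (level `0`, `Q′₀ = id`) and `Q′₁(H′Y⋆)(0) = Y⋆(1, 0) = 1`, but `Q′₁` of the zero function is `0`.
The mechanism of ref-A g15 READ-23 (`sletL_sub3_unsatisfiable`). [cite: Balaban1985RegularSpaces, (1.5) p.77, (1.107) p.94; Balaban1985BackgroundPropagators, Thm 3.1 p.397 (`Q′H′ = I`)] -/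
theorem interp_clause_false {L k : ℕ} (hk : 1 ≤ k) {Λ : ℕ → Set (Site d)} (h0 : Λ 0 = Set.univ) (h1 : Λ 1 = Set.univ)
    (U₀ : Site d → Fin d → 𝔸ˣ) (H' : XSpace d k 𝔸 → (Site d → 𝔸))
    (hint : ∀ (Y : XSpace d k 𝔸) (n : ℕ) (hn : n ≤ k) (y : Site d), y ∈ Λ n →
      QprimeIter (zdBlocking d L) (bgT L U₀) n (H' Y) y = Y (⟨n, Nat.lt_succ_of_le hn⟩, y)) : False := by
  classical
  let f : Fin (k + 1) × Site d → 𝔸 := fun p => if p.1.val = 1 then 1 else 0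
  have hf : ∀ p, ‖f p‖ ≤ ‖(1 : 𝔸)‖ := fun p => by
    by_cases hp : p.1.val = 1
    · simp only [f, hp, if_true, le_refl]
    · simp only [f, hp, if_false, norm_zero, norm_nonneg]
  let Y : XSpace d k 𝔸 := BoundedContinuousFunction.ofNormedAddCommGroupDiscrete f ‖(1 : 𝔸)‖ hf
  have hY : ∀ p, Y p = f p := fun _ => rfl
  -- level 0 on `Λ₀ = ℤᵈ`: `H′Y = Y(0, ·) = 0`
  have hH0 : H' Y = fun _ => 0 := by
    funext y
    have h := hint Y 0 (Nat.zero_le _) y (by rw [h0]; exact Set.mem_univ _)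
    rw [B7Eq78Linearization.QprimeIter_zero] at h
    rw [h, hY]
    simp [f]
  -- level 1 at `y = 0 ∈ Λ₁ = ℤᵈ`: `Q′₁(0)(0) = Y(1, 0) = 1`
  have h := hint Y 1 hk 0 (by rw [h1]; exact Set.mem_univ _)
  rw [hH0, B8Eq138LandauZd.QprimeIter_zero_fun L U₀ 1 0, hY] at h
  have h1' : f (⟨1, Nat.lt_succ_of_le hk⟩, 0) = 1 := by simp [f]
  rw [h1'] at h
  exact zero_ne_one h

/-- **`SockLettersRD` FAILS AT THE WITNESS**: with `Ω_j = Λs m j = ℤᵈ`, `k ≥ 1`, at `α₀ := cL`, the unit background `U₀ := 1` (unitary; `1 ∈ 𝔄_k` by `one_inAk`) and the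
truncation `n := 1`, the eleventh conjunct of the letters is the contradictory interpolation clause of `interp_clause_false`.
[cite: Balaban1985RegularSpaces, (1.5) p.77, (1.107) p.94; Balaban1985BackgroundPropagators, Thm 3.1 p.397] -/
theorem not_sockLettersRD_allUniv {L : ℕ} (hL : 1 ≤ L) {BG BR B₀'H B₂' cL η : ℝ} (hcL : 0 < cL) (hη : 0 < η) {k : ℕ} (hk : 1 ≤ k) :
    ¬ SockLettersRD (𝔸 := 𝔸) L BG BR B₀'H B₂' cL η k (fun _ => (Set.univ : Set (Site d))) (fun _ _ => Set.univ) := by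
  intro h
  have h1u : ∀ x κ, (1 : Site d → Fin d → 𝔸ˣ) x κ ∈ unitaryUnits 𝔸 := fun _ _ => (unitaryUnits 𝔸).one_mem
  obtain ⟨g, Δ, q, qs, Aw, c, H', -, -, -, -, -, -, -, -, -, -, hint, -⟩ :=
    h cL hcL le_rfl 1 h1u (B8Prop6OfThm4.one_inAk hL k hη hcL _) 1 le_rfl hk
  exact interp_clause_false (L := L) (k := 1) le_rfl (Λ := fun _ => Set.univ) rfl rfl 1 H' hint

end Interp

/-! ## §3 The two letters binders of the knits of record are unsatisfiable (their texts, generic in `d L 𝔸`) -/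

section Binders

variable {𝔸 : Type*} [CStarAlgebra 𝔸] [Nontrivial 𝔸]

/-- ★★ **THE BINDER `SLet` IS UNSATISFIABLE** — the text of p609803 `…N05SubBP2CSlotExistsGammaPrime` :150 (= p606531's), generic in `d L 𝔸`: [4]'s RD letters
`SockLettersRD` demanded at EVERY `Ω₀ = ℤᵈ` member obeying the four located laws and (1.3)–(1.4) — instantiate at the witness `i⋆` of §1 (`L ≥ 1`, `cL > 0`).  Hence every theorem
carrying `SLet` among its hypotheses holds ex falso; the honest binder ranges over the (1.5)-obeying members only.
[cite: Balaban1985RegularSpaces, (1.3)–(1.6) p.77, (1.107) p.94; Balaban1985BackgroundPropagators, Thm 3.1 p.397] -/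
theorem sLet_idxB8LawsB_unsatisfiable {L : ℕ} (hL : 1 ≤ L) {BG BR B₀'H B₂' cL : ℝ} (hcL : 0 < cL)
    (SLet : ∀ i : ZdIdx d L, i.Ω 0 = Set.univ → IdxB8LawsB L i → DomainSeq L i.Ω →
      SockLettersRD (𝔸 := 𝔸) L BG BR B₀'H B₂' cL i.η i.k i.Ω i.Λs) : False := by
  obtain ⟨i, h0, hlaws, hdom, hk, hη, hΩ, hΛ⟩ := exists_member_allUniv (d := d) hL
  have h := SLet i h0 hlaws hdom
  have hΩ' : i.Ω = fun _ => Set.univ := funext hΩ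
  have hΛ' : i.Λs = fun _ _ => Set.univ := funext fun m => funext (hΛ m)
  rw [hΩ', hΛ', hk] at h
  exact not_sockLettersRD_allUniv hL hcL hη le_rfl h

/-- ★ **THE BINDER `SLetUB` IS UNSATISFIABLE** — the uniqueness-side letters display of p609803 :153–:170 VERBATIM (generic in `d L 𝔸`): at the witness `i⋆` of §1, the unit
background (`1 ∈ 𝔄_k`, `α₀ := cL`) yields an `H′` with the contradictory interpolation clause (tenth conjunct).  Hence every theorem carrying `SLetUB` holds ex falso.
[cite: Balaban1985RegularSpaces, (1.3)–(1.6) p.77, (1.107) p.94, (1.109) p.94; Balaban1985BackgroundPropagators, Thm 3.1 p.397] -/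
theorem sLetUB_idxB8LawsB_unsatisfiable {L : ℕ} (hL : 1 ≤ L) {BG BR B₀'H B₂' cL : ℝ} (hcL : 0 < cL)
    (SLetUB : ∀ i : ZdIdx d L, i.Ω 0 = Set.univ → IdxB8LawsB L i → DomainSeq L i.Ω → ∀ α₀ : ℝ, 0 < α₀ → α₀ ≤ cL →
      ∀ U₀ : Site d → Fin d → 𝔸ˣ, (∀ x κ, U₀ x κ ∈ unitaryUnits 𝔸) → InAk L i.k i.η α₀ i.Ω U₀ →
      ∃ (g Δ : (Site d → 𝔸) →ₗ[ℂ] (Site d → 𝔸)) (q : (Site d → 𝔸) →ₗ[ℂ] (ℕ → Site d → 𝔸))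
        (qs : (ℕ → Site d → 𝔸) →ₗ[ℂ] (Site d → 𝔸)) (Aw c : (ℕ → Site d → 𝔸) →ₗ[ℂ] (ℕ → Site d → 𝔸))
        (H' : XSpace d i.k 𝔸 →ₗ[ℂ] (Site d → 𝔸)),
        (∀ x : Site d → 𝔸, (∃ C : ℝ, ∀ y, ‖x y‖ ≤ C) → g (Δ x + qs (Aw (q x))) = x) ∧ (∀ φ, qs (c (q (g (g (qs φ))))) = qs φ) ∧
        (∀ (f : Site d → 𝔸), ∀ x ∈ i.Ω 0, Δ f x = covLap i.η U₀ ((i.Ω 0).indicator f) x) ∧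
        (∀ (μ : ℕ → Site d → 𝔸), ∀ x ∈ i.Ω 0, qs μ x = QT L i.k (i.Λs i.k) U₀ μ x) ∧
        (∀ (f : Site d → 𝔸) (n : ℕ), n ≤ i.k → ∀ y ∈ i.Λs i.k n, q f n y = QprimeIter (zdBlocking d L) (bgT L U₀) n f y) ∧
        (∀ (f : Site d → 𝔸) (n : ℕ) (y : Site d), ¬ (n ≤ i.k ∧ y ∈ i.Λs i.k n) → q f n y = 0) ∧
        (∀ (X : XSpace d i.k 𝔸) (x : Site d), ‖H' X x‖ ≤ B₀'H * ‖X‖) ∧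
        (∀ n, n ≤ i.k → ∀ (X : XSpace d i.k 𝔸), ∀ p ∈ {b : Site d × Fin d | SideTouches (i.Ω n) b.1 b.2},
          wt L i.η n * ‖covDerivFwd i.η U₀ p.2 (H' X) p.1‖ ≤ B₀'H * ‖X‖) ∧
        (∀ X : XSpace d i.k 𝔸, Bd2 L i.η i.k i.Ω (covLap i.η U₀ (H' X)) (B₂' * ‖X‖)) ∧
        (∀ (Y : XSpace d i.k 𝔸) (n : ℕ) (hn : n ≤ i.k) (y : Site d), y ∈ i.Λs i.k n →
          QprimeIter (zdBlocking d L) (bgT L U₀) n (H' Y) y = Y (⟨n, Nat.lt_succ_of_le hn⟩, y)) ∧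
        (∀ (f : Site d → 𝔸) (r : ℝ), 0 ≤ r → Bd2 L i.η i.k i.Ω f r →
          (∀ x, ‖g f x‖ ≤ BG * r) ∧ ∀ n, n ≤ i.k → ∀ p ∈ {b : Site d × Fin d | SideTouches (i.Ω n) b.1 b.2},
            wt L i.η n * ‖covDerivFwd i.η U₀ p.2 (g f) p.1‖ ≤ BG * r) ∧
        (∀ (f : Site d → 𝔸) (r : ℝ), 0 ≤ r → Bd2 L i.η i.k i.Ω f r → Bd2 L i.η i.k i.Ω (f - g (qs (c (q (g f))))) (BR * r))) :
    False := by
  obtain ⟨i, h0, hlaws, hdom, hk, hη, hΩ, hΛ⟩ := exists_member_allUniv (d := d) hL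
  have h1u : ∀ x κ, (1 : Site d → Fin d → 𝔸ˣ) x κ ∈ unitaryUnits 𝔸 := fun _ _ => (unitaryUnits 𝔸).one_mem
  obtain ⟨g, Δ, q, qs, Aw, c, H', -, -, -, -, -, -, -, -, -, hint, -⟩ :=
    SLetUB i h0 hlaws hdom cL hcL le_rfl 1 h1u (B8Prop6OfThm4.one_inAk hL i.k i.hη hcL _)
  exact interp_clause_false (L := L) (k := i.k) i.hk (Λ := i.Λs i.k) (hΛ i.k 0) (hΛ i.k 1) 1 H' hint

end Binders

/-! ## §4 The instances the knits display (`θ.D θ.L θ.𝔸`, `θ : Node00.Stage3Params`) -/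

section Stage3

/-- **`SLet` AT THE RECORD'S DATA IS UNSATISFIABLE** — the binder of p609803 ∕ p606531 letter for letter (`θ.D`, `θ.L ≥ 2`, the bundled coefficient C⋆-algebra `θ.𝔸`).
[cite: Balaban1985RegularSpaces, (1.3)–(1.6) p.77, (1.107) p.94; Balaban1985BackgroundPropagators, Thm 3.1 p.397] -/
theorem sLet_idxB8LawsB_unsatisfiable_stage3 (θ : Node00.Stage3Params) {BG BR B₀'H B₂' cL : ℝ} (hcL : 0 < cL)
    (SLet : ∀ i : ZdIdx θ.D θ.L, i.Ω 0 = Set.univ → IdxB8LawsB θ.L i → DomainSeq θ.L i.Ω →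
      SockLettersRD (𝔸 := θ.𝔸) θ.L BG BR B₀'H B₂' cL i.η i.k i.Ω i.Λs) : False :=
  sLet_idxB8LawsB_unsatisfiable (le_trans one_le_two θ.two_le_L) hcL SLet

/-- **`SLetUB` AT THE RECORD'S DATA IS UNSATISFIABLE** — the display of p609803 :153–:170 letter for letter at `θ.D θ.L θ.𝔸`.
[cite: Balaban1985RegularSpaces, (1.3)–(1.6) p.77, (1.107)–(1.109) p.94; Balaban1985BackgroundPropagators, Thm 3.1 p.397] -/
theorem sLetUB_idxB8LawsB_unsatisfiable_stage3 (θ : Node00.Stage3Params) {BG BR B₀'H B₂' cL : ℝ} (hcL : 0 < cL)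
    (SLetUB : ∀ i : ZdIdx θ.D θ.L, i.Ω 0 = Set.univ → IdxB8LawsB θ.L i → DomainSeq θ.L i.Ω → ∀ α₀ : ℝ, 0 < α₀ → α₀ ≤ cL →
      ∀ U₀ : Site θ.D → Fin θ.D → θ.𝔸ˣ, (∀ x κ, U₀ x κ ∈ unitaryUnits θ.𝔸) → InAk θ.L i.k i.η α₀ i.Ω U₀ →
      ∃ (g Δ : (Site θ.D → θ.𝔸) →ₗ[ℂ] (Site θ.D → θ.𝔸)) (q : (Site θ.D → θ.𝔸) →ₗ[ℂ] (ℕ → Site θ.D → θ.𝔸))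
        (qs : (ℕ → Site θ.D → θ.𝔸) →ₗ[ℂ] (Site θ.D → θ.𝔸)) (Aw c : (ℕ → Site θ.D → θ.𝔸) →ₗ[ℂ] (ℕ → Site θ.D → θ.𝔸))
        (H' : XSpace θ.D i.k θ.𝔸 →ₗ[ℂ] (Site θ.D → θ.𝔸)),
        (∀ x : Site θ.D → θ.𝔸, (∃ C : ℝ, ∀ y, ‖x y‖ ≤ C) → g (Δ x + qs (Aw (q x))) = x) ∧ (∀ φ, qs (c (q (g (g (qs φ))))) = qs φ) ∧
        (∀ (f : Site θ.D → θ.𝔸), ∀ x ∈ i.Ω 0, Δ f x = covLap i.η U₀ ((i.Ω 0).indicator f) x) ∧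
        (∀ (μ : ℕ → Site θ.D → θ.𝔸), ∀ x ∈ i.Ω 0, qs μ x = QT θ.L i.k (i.Λs i.k) U₀ μ x) ∧
        (∀ (f : Site θ.D → θ.𝔸) (n : ℕ), n ≤ i.k → ∀ y ∈ i.Λs i.k n, q f n y = QprimeIter (zdBlocking θ.D θ.L) (bgT θ.L U₀) n f y) ∧
        (∀ (f : Site θ.D → θ.𝔸) (n : ℕ) (y : Site θ.D), ¬ (n ≤ i.k ∧ y ∈ i.Λs i.k n) → q f n y = 0) ∧
        (∀ (X : XSpace θ.D i.k θ.𝔸) (x : Site θ.D), ‖H' X x‖ ≤ B₀'H * ‖X‖) ∧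
        (∀ n, n ≤ i.k → ∀ (X : XSpace θ.D i.k θ.𝔸), ∀ p ∈ {b : Site θ.D × Fin θ.D | SideTouches (i.Ω n) b.1 b.2},
          wt θ.L i.η n * ‖covDerivFwd i.η U₀ p.2 (H' X) p.1‖ ≤ B₀'H * ‖X‖) ∧
        (∀ X : XSpace θ.D i.k θ.𝔸, Bd2 θ.L i.η i.k i.Ω (covLap i.η U₀ (H' X)) (B₂' * ‖X‖)) ∧
        (∀ (Y : XSpace θ.D i.k θ.𝔸) (n : ℕ) (hn : n ≤ i.k) (y : Site θ.D), y ∈ i.Λs i.k n →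
          QprimeIter (zdBlocking θ.D θ.L) (bgT θ.L U₀) n (H' Y) y = Y (⟨n, Nat.lt_succ_of_le hn⟩, y)) ∧
        (∀ (f : Site θ.D → θ.𝔸) (r : ℝ), 0 ≤ r → Bd2 θ.L i.η i.k i.Ω f r →
          (∀ x, ‖g f x‖ ≤ BG * r) ∧ ∀ n, n ≤ i.k → ∀ p ∈ {b : Site θ.D × Fin θ.D | SideTouches (i.Ω n) b.1 b.2},
            wt θ.L i.η n * ‖covDerivFwd i.η U₀ p.2 (g f) p.1‖ ≤ BG * r) ∧
        (∀ (f : Site θ.D → θ.𝔸) (r : ℝ), 0 ≤ r → Bd2 θ.L i.η i.k i.Ω f r → Bd2 θ.L i.η i.k i.Ω (f - g (qs (c (q (g f))))) (BR * r))) :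
    False :=
  sLetUB_idxB8LawsB_unsatisfiable (le_trans one_le_two θ.two_le_L) hcL SLetUB

end Stage3

end Literature.MathematicalPhysics.QuantumFieldTheory.Balaban1983to89.B8SockLettersRDIdxB8LawsBVacuity

end
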